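import Summits.AtomisticToContinuum.Crystallization.Theorems.FrustratedLawDichotomyStrainedPatchHomCurvCentreKit

/-!
# Centred curvature leaf, kit v2: the displacement enclosure through the COORDINATES of `w_b` (tight), with tube and norm bounds

decomp-a2c hand-1 g27 (crux `AperiodicFrustratedLawGap`, stmt-AtomisticToContinuum-27623; `(H) HomFloor (1/625)`, hcp half; lever (C)).
`…HomCurvCentreKit.dVec` encloses the `(U − U_c)w_b` part of the displacement through `vecB` in the hexFrame basis, i.e. with widths weighted by
`Σ_i |b_i|·|f_i|` (≈ 3.6 for a first-shell label with two non-zero indices, against `‖w_b‖ ≈ 0.97`).  MEASURED (hand-1 g27, compiled evaluation of the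
landed leaf): per-label `‖d_b‖²` bound `1.9e-4` for `b = (0,0,0)` but `5.2–5.8e-4` for `(−1,0,−1), (0,−1,−1)`, inflating the second-order remainder
`2.7×`.  This file encloses that part as `Σ_l (U − U_c)_kl (w_b)_l` with the TIGHT coordinates `wVec ∋ w_b` (`dVec2`), and repeats the downstream
bounds: `nd2S2`, `ndS2`, `tube2`, ★ `tube2_mem`.

Kernel definitions + soundness; 0 sorry; standard axioms; no instances / notation / `#eval`.  `--supports stmt-AtomisticToContinuum-27623`.
-/

noncomputable section

namespace Summit.AtomisticToContinuum.Crystallization.Theorems.FrustratedLawDichotomyStrainedPatchHomCurvCentreKit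

open scoped BigOperators RealInnerProductSpace
open Literature.Analysis.ValidatedNumerics.Numerics
open Summit.AtomisticToContinuum.Crystallization.Theorems.ChargedEnergyGapNegative (E3)
open Summit.AtomisticToContinuum.Crystallization.Theorems.FrustratedLawDichotomyStrainedPatchHomSplit (latPt hexFrame hcpShift)
open Summit.AtomisticToContinuum.Crystallization.Theorems.FrustratedLawDichotomyStrainedPatchHomEntryGram (entryFI mem_entryFI)
open Summit.AtomisticToContinuum.Crystallization.Theorems.FrustratedLawDichotomyStrainedPatchHomEntryGramHcp (dot3 shufFI mem_dot3 mem_shufFI)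
open Summit.AtomisticToContinuum.Crystallization.Theorems.FrustratedLawDichotomyStrainedPatchHomForceKit (vecB mem_vecB cId)
open Summit.AtomisticToContinuum.Crystallization.Theorems.FrustratedLawDichotomyStrainedPatchHomCoords (apply_eq_sum_entries)
open Summit.AtomisticToContinuum.Crystallization.Theorems.FrustratedLawDichotomyStrainedPatchHomCurvCoeff (rhoFI mem_rhoFI)
open Summit.AtomisticToContinuum.Crystallization.Theorems.FrustratedLawDichotomyStrainedPatchHomCurvCentre (labelPoint_sub_eq norm_sq_le_of_abs_le)

/-! ## §1. The tight displacement enclosure -/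

/-- Displacement `d_b = (U − U_c)w_b + U(η − η_c)` through the coordinates of `w_b` (tight). -/
def dVec2 (c w : (Fin 3 × Fin 3) ⊕ Fin 3 → ℤ) (b : Fin 3 → ℤ) (a : Fin 3) : FI :=
  (mulVecFI (difE w) (wVec c b) a).add (mulVecFI (boxE c w) (difX w) a)
/-- Scaled bound of `‖d_b‖²` (v2). -/
def nd2S2 (c w : (Fin 3 × Fin 3) ⊕ Fin 3 → ℤ) (b : Fin 3 → ℤ) : ℤ := cdiv (∑ k : Fin 3, (dVec2 c w b k).absHi ^ 2) SC
/-- Scaled bound of `‖d_b‖` (v2). -/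
def ndS2 (c w : (Fin 3 × Fin 3) ⊕ Fin 3 → ℤ) (b : Fin 3 → ℤ) : ℤ := (FI.sqrt ⟨0, nd2S2 c w b⟩).hi
/-- The tube interval (v2). -/
def tube2 (c w : (Fin 3 × Fin 3) ⊕ Fin 3 → ℤ) (b : Fin 3 → ℤ) : FI := ⟨(rho0 c b).lo - ndS2 c w b - 1, (rho0 c b).hi + ndS2 c w b + 1⟩

/-- ★ `dVec2` encloses the displacement `c_b − p_b`. [folklore chaining] -/
theorem mem_dVec2 {c w : (Fin 3 × Fin 3) ⊕ Fin 3 → ℤ} (U : E3 →L[ℝ] E3)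
    (hbox : ∀ ab : Fin 3 × Fin 3, |(U (EuclideanSpace.single ab.2 (1 : ℝ))) ab.1 - (c (Sum.inl ab) : ℝ) / SC| ≤ (w (Sum.inl ab) : ℝ) / SC)
    (η : E3) (hη : ∀ i : Fin 3, |η i - (c (Sum.inr i) : ℝ) / SC| ≤ (w (Sum.inr i) : ℝ) / SC) (b : Fin 3 → ℤ) (a : Fin 3) :
    FI.mem ((latPt U hexFrame b + U (hcpShift + η) - cenPt c b) a) (dVec2 c w b a) := by
  rw [cenPt, labelPoint_sub_eq, PiLp.add_apply]
  have hw : latPt (U - cenMap c) hexFrame b + (U - cenMap c) (hcpShift + cenShuf c) = (U - cenMap c) (wPt c b) := by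
    simp [wPt, latPt, map_add]
  rw [hw]
  refine FI.mem_add ?_ ?_
  · refine mem_mulVecFI (U - cenMap c) (wPt c b) (fun ab => mem_entryFI ?_) (fun l => mem_wVec c b l) a
    rw [show ((U - cenMap c) (EuclideanSpace.single ab.2 (1 : ℝ))) ab.1 =
        (U (EuclideanSpace.single ab.2 (1 : ℝ))) ab.1 - (cenMap c (EuclideanSpace.single ab.2 (1 : ℝ))) ab.1 from rfl, cenMap_entry]
    simpa using hbox ab
  · refine mem_mulVecFI U (η - cenShuf c) (fun ab => mem_entryFI (hbox ab)) (fun l => mem_shufFI ?_) a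
    rw [PiLp.sub_apply, cenShuf_apply]
    simpa [zW] using hη l

/-- `‖d_b‖²·SC ≤ nd2S` (from the componentwise `absHi`). [folklore] -/
theorem norm_sq_dVec2_le {c w : (Fin 3 × Fin 3) ⊕ Fin 3 → ℤ} (U : E3 →L[ℝ] E3)
    (hbox : ∀ ab : Fin 3 × Fin 3, |(U (EuclideanSpace.single ab.2 (1 : ℝ))) ab.1 - (c (Sum.inl ab) : ℝ) / SC| ≤ (w (Sum.inl ab) : ℝ) / SC)
    (η : E3) (hη : ∀ i : Fin 3, |η i - (c (Sum.inr i) : ℝ) / SC| ≤ (w (Sum.inr i) : ℝ) / SC) (b : Fin 3 → ℤ) :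
    ‖latPt U hexFrame b + U (hcpShift + η) - cenPt c b‖ ^ 2 * SC ≤ (nd2S2 c w b : ℝ) := by
  have hS : (0 : ℝ) < SC := by norm_num [SC]
  set d := latPt U hexFrame b + U (hcpShift + η) - cenPt c b with hd
  have hk : ∀ k, |d k| ≤ ((dVec2 c w b k).absHi : ℝ) / SC := fun k => by
    rw [le_div_iff₀ hS]; exact FI.abs_le_absHi (mem_dVec2 U hbox η hη b k)
  have h1 := norm_sq_le_of_abs_le d _ hk
  have h2 : (∑ k : Fin 3, (((dVec2 c w b k).absHi : ℝ) / SC) ^ 2) * SC = (∑ k : Fin 3, ((dVec2 c w b k).absHi : ℝ) ^ 2) / SC := by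
    rw [Finset.sum_mul, Finset.sum_div]
    exact Finset.sum_congr rfl fun k _ => by field_simp
  have h3 : (∑ k : Fin 3, ((dVec2 c w b k).absHi : ℝ) ^ 2) / SC ≤ (nd2S2 c w b : ℝ) := by
    have := div_le_cdiv (a := ∑ k : Fin 3, (dVec2 c w b k).absHi ^ 2) (b := (SC : ℤ)) (by exact_mod_cast hS)
    push_cast at this
    exact this
  calc ‖d‖ ^ 2 * SC ≤ (∑ k : Fin 3, (((dVec2 c w b k).absHi : ℝ) / SC) ^ 2) * SC := mul_le_mul_of_nonneg_right h1 hS.le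
    _ = _ := h2
    _ ≤ _ := h3

/-- `‖d_b‖·SC ≤ ndS`. [folklore] -/
theorem norm_dVec2_le {c w : (Fin 3 × Fin 3) ⊕ Fin 3 → ℤ} (U : E3 →L[ℝ] E3)
    (hbox : ∀ ab : Fin 3 × Fin 3, |(U (EuclideanSpace.single ab.2 (1 : ℝ))) ab.1 - (c (Sum.inl ab) : ℝ) / SC| ≤ (w (Sum.inl ab) : ℝ) / SC)
    (η : E3) (hη : ∀ i : Fin 3, |η i - (c (Sum.inr i) : ℝ) / SC| ≤ (w (Sum.inr i) : ℝ) / SC) (b : Fin 3 → ℤ) :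
    ‖latPt U hexFrame b + U (hcpShift + η) - cenPt c b‖ * SC ≤ (ndS2 c w b : ℝ) := by
  set d := latPt U hexFrame b + U (hcpShift + η) - cenPt c b with hd
  have hmem : FI.mem (‖d‖ ^ 2) ⟨0, nd2S2 c w b⟩ := by
    refine ⟨?_, ?_⟩
    · push_cast; positivity
    · exact norm_sq_dVec2_le U hbox η hη b
  have hs := FI.mem_sqrt hmem
  rw [Real.sqrt_sq (norm_nonneg _)] at hs
  exact hs.2

/-! ## §2. The tube (v2) -/

/-- ★ **The tube contains the path**: for `U, η` in the box and `t ∈ [0,1]`, `tube.lo/SC < ‖p_b + t d_b‖ < tube.hi/SC`. [folklore] -/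
theorem tube2_mem {c w : (Fin 3 × Fin 3) ⊕ Fin 3 → ℤ} (U : E3 →L[ℝ] E3)
    (hbox : ∀ ab : Fin 3 × Fin 3, |(U (EuclideanSpace.single ab.2 (1 : ℝ))) ab.1 - (c (Sum.inl ab) : ℝ) / SC| ≤ (w (Sum.inl ab) : ℝ) / SC)
    (η : E3) (hη : ∀ i : Fin 3, |η i - (c (Sum.inr i) : ℝ) / SC| ≤ (w (Sum.inr i) : ℝ) / SC) (b : Fin 3 → ℤ) {t : ℝ} (ht : t ∈ Set.Icc (0 : ℝ) 1) :
    ((tube2 c w b).lo : ℝ) / SC < ‖cenPt c b + t • (latPt U hexFrame b + U (hcpShift + η) - cenPt c b)‖ ∧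
      ‖cenPt c b + t • (latPt U hexFrame b + U (hcpShift + η) - cenPt c b)‖ < ((tube2 c w b).hi : ℝ) / SC := by
  have hS : (0 : ℝ) < SC := by norm_num [SC]
  set p := cenPt c b with hp
  set d := latPt U hexFrame b + U (hcpShift + η) - cenPt c b with hd
  have hρ := (mem_rho0 c b).2
  have hlo : ((rho0 c b).lo : ℝ) ≤ ‖p‖ * SC := hρ.1
  have hhi : ‖p‖ * SC ≤ ((rho0 c b).hi : ℝ) := hρ.2
  have hdn : ‖d‖ * SC ≤ (ndS2 c w b : ℝ) := norm_dVec2_le U hbox η hη b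
  have htd : ‖t • d‖ ≤ ‖d‖ := by
    rw [norm_smul, Real.norm_eq_abs, abs_of_nonneg ht.1]; exact mul_le_of_le_one_left (norm_nonneg _) ht.2
  have h1 : ‖p‖ - ‖d‖ ≤ ‖p + t • d‖ := by
    have := norm_sub_norm_le p (-(t • d))
    rw [sub_neg_eq_add, norm_neg] at this
    linarith [abs_le.1 (abs_norm_sub_norm_le p (p + t • d))]
  have h1' : ‖p‖ - ‖d‖ ≤ ‖p + t • d‖ := by
    have := norm_le_norm_add_norm_sub' p (p + t • d)
    have e : p - (p + t • d) = -(t • d) := by abel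
    rw [e, norm_neg] at this
    linarith
  have h2 : ‖p + t • d‖ ≤ ‖p‖ + ‖d‖ := (norm_add_le _ _).trans (by linarith)
  simp only [tube2]
  push_cast
  constructor
  · rw [div_lt_iff₀ hS]; nlinarith
  · rw [lt_div_iff₀ hS]; nlinarith

end Summit.AtomisticToContinuum.Crystallization.Theorems.FrustratedLawDichotomyStrainedPatchHomCurvCentreKit

end
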